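import Summits.HodgeConjecture.Statement
import Summits.HodgeConjecture.HodgeConjecture.Theorems.WeilTypeLadder
import Summits.HodgeConjecture.HodgeConjecture.Theorems.WeilTypeLadderVariational
import Summits.HodgeConjecture.HodgeConjecture.Theses.PadicSemiregularLift
import Literature.AlgebraicGeometry.HodgeTheory.IsoTransport
import Literature.AlgebraicGeometry.HodgeTheory.FermatHypersurfaceReduction
import Literature.AlgebraicGeometry.Motives.AbelianVarietyProjectiveChart
import HarnessLib

/-!
# WeilTypeLadder · R3var ON-PATH lemma and arrows, kernel-checked (b2b cell `hweil`, prover 2)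

For the variational rung `WeilTypeLadder.WeilVariationalHodgeCMField` (R3var, conjecture leaf
`Theorems/WeilTypeLadderVariational.lean`, p175609; analysis `run/shared/lean/b2b/hodge-weil/b2b-hweil-pv2/COR-11-2-4.md`):

* `weilVariationalHodgeCMField_of_hodgeConjecture` — the ON-PATH LEMMA `HodgeConjecture → R3var` (TYPE II
  ladder: R3var is a CASE of the summit — apply `HodgeConjectureFor` to the fibre `𝒳_s`, smooth projective by
  `IsSmoothProjectiveFamily.isSmoothProjective`, and to `W|_{𝒳_s}`, rational of type `(m,m)`; Charles–Schnell
  2014, Cor. 11.3.6: "The Hodge conjecture implies the variational Hodge conjecture");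
* `weilVariationalHodgeCMField_of_hodgeAbelianVarieties` — the same from the item
  `PadicSemiregularLift.HodgeAbelianVarieties` (stmt-HodgeConjecture-1333, HC for every complex abelian
  variety): read `W|_{𝒳_s}` on the chart `e′ : A′.X ≅ 𝒳_s` and transport back (`isRationalClass_map_iff_of_iso`,
  `isOfHodgeType_map_iff_of_iso`, `mem_algebraicClasses_map_iff_of_iso`);
* `weilVariationalHodgeCMField_of_weilClassesCMField_of_lt` — the arrow R3 → R3var for CM fields of degree
  `e > 2`: the POINTWISE rung `WeilClassesCMField` (every rational `(m,m)`-class of `weilClassesField A φ P (2m)`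
  algebraic) gives the variational rung fibre by fibre through the chart, with no use of the anchor or of the
  base (so R3var is genuinely WEAKER than R3 on `e > 2`; for `e = 2` the route crux
  `HeckePrymWeil.WeilVariationalHodge`, stmt-14497, is the stronger statement).

The converse "R3var ⟹ R3 on the split components" is Markman's Thm. 1.1.2 / Cor. 11.2.4 (arXiv:2509.23079)
granted generic `B`-secant sheaves at a product point `X × X̂` of every component (companion Question 12.2.2)
— print, unrefereed, not typed. Serves stmt-HodgeConjecture-14497 without closing it. Sorry-free; no definition.
-/

-- every declaration of this problem lives in `Summit.HodgeConjecture.HodgeConjecture.…` (summit = sub-problem)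
set_option linter.dupNamespace false

noncomputable section

open CategoryTheory

namespace Summit.HodgeConjecture.HodgeConjecture.WeilTypeLadder

open Literature.AlgebraicGeometry Literature.AlgebraicGeometry.Motives
open Literature.AlgebraicGeometry.HodgeTheory
open Literature.AlgebraicTopology.SingularHomology
open Summit.HodgeConjecture.HodgeConjecture.Theses

/-- **On-path lemma: the Hodge conjecture implies R3var** (the variational rung is a case of the summit:
`W|_{𝒳_s}` is a rational `(m,m)`-class on the smooth projective fibre `𝒳_s`). The CM, Weil-confinement,
quasi-projectivity, base and anchor hypotheses are not used. [cite: CharlesSchnell2014Notes, Cor. 11.3.6 (p. 479)] -/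
theorem weilVariationalHodgeCMField_of_hodgeConjecture (h : _root_.HodgeConjecture) :
    WeilVariationalHodgeCMField :=
  fun _ _ m _ _ _ _ _ _ _ _ _ hf _ _ _ _ _ hW _ _ s ↦
    (h (hf.isSmoothProjective s)).2 m _ (hW s).1 (hW s).2

/-- **R3var from the Hodge conjecture for abelian varieties** (`PadicSemiregularLift.HodgeAbelianVarieties`,
stmt-HodgeConjecture-1333): read the fibre class on the abelian chart `e′ : A′.X ≅ 𝒳_s` (rationality and Hodge
type transport along isomorphisms), apply HC for `A′` (of dimension `e·m`), transport algebraicity back.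
[folklore] -/
theorem weilVariationalHodgeCMField_of_hodgeAbelianVarieties (h : PadicSemiregularLift.HodgeAbelianVarieties) :
    WeilVariationalHodgeCMField := by
  intro P e m _ _ _ _ _ _ 𝒳 S f _ _ _ _ _ W hW hWeil _ s
  obtain ⟨A', φ', e', _, hdim, _⟩ := hWeil s
  have hA'dim : A'.dim = e * m := by
    have h2 : e * (2 * m) = 2 * (e * m) := by ring
    omega
  have hrat : IsRationalClass
      (complexBetti.map e'.hom (2 * m) (complexBetti.map (Motives.fiberι f s) (2 * m) W)) :=
    (isRationalClass_map_iff_of_iso e').2 (hW s).1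
  have hhodge : IsOfHodgeType A'.dim A'.X (2 * m) m m
      (complexBetti.map e'.hom (2 * m) (complexBetti.map (Motives.fiberι f s) (2 * m) W)) := by
    rw [hA'dim]
    exact (isOfHodgeType_map_iff_of_iso e').2 (hW s).2
  exact (mem_algebraicClasses_map_iff_of_iso e').1 ((h A').2 m _ hrat hhodge)

/-- **Arrow R3 → R3var for CM fields of degree `e > 2`**: the pointwise rung `WeilClassesCMField` implies the
variational rung fibre by fibre — on the chart `e′ : A′.X ≅ 𝒳_s` the class
`e′^*(W|_{𝒳_s}) ∈ weilClassesField A′ φ′ P (2m)` is rational of type `(m,m)` (transport along the iso,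
`A′.dim = e·m`), hence algebraic by R3, hence `W|_{𝒳_s}` is algebraic (transport back). Stated with the
R3var binders and the extra hypothesis `2 < e` of R3. [folklore] -/
theorem weilVariationalHodgeCMField_of_weilClassesCMField_of_lt (h3 : WeilClassesCMField) :
    ∀ (P : Polynomial ℤ) (e m : ℕ), P.Monic → P.natDegree = e → 2 < e →
      Irreducible (P.map (Int.castRingHom ℚ)) →
      (∀ ρ : ℂ, Polynomial.eval₂ (Int.castRingHom ℂ) ρ P = 0 → starRingEnd ℂ ρ ≠ ρ) →
      (∃ Q : Polynomial ℚ, ∀ ρ : ℂ, Polynomial.eval₂ (Int.castRingHom ℂ) ρ P = 0 →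
          Polynomial.eval₂ (algebraMap ℚ ℂ) ρ Q = starRingEnd ℂ ρ) →
      1 ≤ m →
      ∀ ⦃𝒳 S : Motives.SchemeOver ℂ⦄ (f : 𝒳 ⟶ S), Motives.IsSmoothProjectiveFamily f (e * m) →
        IsQuasiProjectiveOver 𝒳 → IsQuasiProjectiveOver S → IrreducibleSpace S.left →
        AlgebraicGeometry.Smooth S.hom →
        ∀ (W : complexBetti 𝒳 (2 * m)),
          (∀ s : Motives.ComplexPoints S,
            IsRationalClass (complexBetti.map (Motives.fiberι f s) (2 * m) W) ∧
              IsOfHodgeType (e * m) (Motives.fiberOver f s) (2 * m) m m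
                (complexBetti.map (Motives.fiberι f s) (2 * m) W)) →
          (∀ s : Motives.ComplexPoints S, ∃ (A' : Motives.AbelianVariety ℂ) (φ' : A' ⟶ A')
              (e' : A'.X ≅ Motives.fiberOver f s),
            Polynomial.eval₂ (Int.castRingHom (CategoryTheory.End A')) (φ' : CategoryTheory.End A') P = 0 ∧
              e * (2 * m) = 2 * A'.dim ∧
              complexBetti.map e'.hom (2 * m) (complexBetti.map (Motives.fiberι f s) (2 * m) W) ∈
                weilClassesField A' φ' P (2 * m)) →
          (∃ s₀ : Motives.ComplexPoints S,
            complexBetti.map (Motives.fiberι f s₀) (2 * m) W ∈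
              algebraicClasses (Motives.fiberOver f s₀) m) →
          ∀ s : Motives.ComplexPoints S,
            complexBetti.map (Motives.fiberι f s) (2 * m) W ∈
              algebraicClasses (Motives.fiberOver f s) m := by
  intro P e m hP hPe he hirr hnr hQ _ 𝒳 S f _ _ _ _ _ W hW hWeil _ s
  obtain ⟨A', φ', e', hφ', hdim, hmem⟩ := hWeil s
  have hA'dim : A'.dim = e * m := by
    have h2 : e * (2 * m) = 2 * (e * m) := by ring
    omega
  have hrat : IsRationalClass
      (complexBetti.map e'.hom (2 * m) (complexBetti.map (Motives.fiberι f s) (2 * m) W)) :=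
    (isRationalClass_map_iff_of_iso e').2 (hW s).1
  have hhodge : IsOfHodgeType A'.dim A'.X (2 * m) m m
      (complexBetti.map e'.hom (2 * m) (complexBetti.map (Motives.fiberι f s) (2 * m) W)) := by
    rw [hA'dim]
    exact (isOfHodgeType_map_iff_of_iso e').2 (hW s).2
  have halg := h3 A' φ' P e m hP hPe he hirr hφ' hdim hnr hQ _ hmem hrat hhodge
  exact (mem_algebraicClasses_map_iff_of_iso e').1 halg

end Summit.HodgeConjecture.HodgeConjecture.WeilTypeLadder

end
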